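/-
Copyright: cell `pub-balaban-gaps` (G2), seat ne6 (row NE7b), `prover-pub-balaban-gaps-ne6-g16-0`. Project licence.
-/
import Summits.QuantumFields.BalabanUV.T4Continuum.Spine.NE7b.CompactFibreWindowSU2Exact
import Summits.QuantumFields.BalabanUV.T4Continuum.Spine.NE7b.CompactFibreWindowSU2Doubling

/-!
# JUNCTION (census V40c): V40a's cap law feeds V40b's `doubling_one_of_capLaw` — window doubling on `SU(2)` with the SHARP constant `D = 1`:
# `Haar{Re tr(1 − V) ≤ λ²t} ≤ λ³·Haar{Re tr(1 − V) ≤ t}` for all `λ ≥ 1`, all real `t` (row NE7b, node U5c; MODEL, [folklore])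

Cell `pub-balaban-gaps` (G2 spine census) for the `pub-balaban` T⁴ crux NE7b (NOT PRINTED, NOT PROVED).  One-theorem junction of two census files of this seat
(filed once both parents' oleans exist on the check farm).  No `def`, zero `sorry`, nothing of Bałaban's asserted.  BY-NAME EFFECT ON THE WALL: NONE.
HONEST DEPENDENCY: continuum YM on T⁴ ⇐ BetaPertH ∧ nine spine estimates (0/9 proved); BetaPertH ⇐ (D1) ∧ (D4) ∧ CAP+tail;
G-an2-4 gates asym, D1 and NE2/3/4.  This file changes none of it.
-/

set_option autoImplicit false

noncomputable section

open MeasureTheory Real Set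
open Literature.MathematicalPhysics.QuantumFieldTheory (haarProbability)
open Summit.QuantumFields.BalabanUV.T4Continuum.NE7b.CompactFibreWindowSU2Exact (haar_traceCap_angle_eq measurableSet_traceCap)
open Summit.QuantumFields.BalabanUV.T4Continuum.NE7b.CompactFibreWindowSU2Doubling (doubling_one_of_capLaw)

namespace Summit.QuantumFields.BalabanUV.T4Continuum.NE7b.CompactFibreWindowSU2DoublingHaar

/-- On `SU(2)`, `Re tr(1 − V) = 2 − Re tr V`. [folklore] -/
theorem re_trace_one_sub_eq (V : Matrix.specialUnitaryGroup (Fin 2) ℂ) :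
    (Matrix.trace (1 - (V : Matrix (Fin 2) (Fin 2) ℂ))).re = 2 - (Matrix.trace (V : Matrix (Fin 2) (Fin 2) ℂ)).re := by
  rw [Matrix.trace_sub, Matrix.trace_one, Complex.sub_re, Fintype.card_fin]; norm_num

/-- `|Re tr V| ≤ 2` on `SU(2)`, hence `0 ≤ Re tr(1 − V) ≤ 4`. [folklore] -/
theorem abs_re_trace_le_two (V : Matrix.specialUnitaryGroup (Fin 2) ℂ) : |(Matrix.trace (V : Matrix (Fin 2) (Fin 2) ℂ)).re| ≤ 2 := by
  have hU : (V : Matrix (Fin 2) (Fin 2) ℂ) ∈ Matrix.unitaryGroup (Fin 2) ℂ := (Matrix.mem_specialUnitaryGroup_iff.1 V.2).1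
  rw [Matrix.trace_fin_two, Complex.add_re]
  have h0 := (abs_le.1 ((Complex.abs_re_le_norm _).trans (entry_norm_bound_of_unitary hU 0 0)))
  have h1 := (abs_le.1 ((Complex.abs_re_le_norm _).trans (entry_norm_bound_of_unitary hU 1 1)))
  rw [abs_le]; constructor <;> linarith [h0.1, h0.2, h1.1, h1.2]

/-- **WINDOW DOUBLING ON `SU(2)` WITH `D = 1`**: `Haar_{SU(2)}{Re tr(1 − V) ≤ λ²·t} ≤ λ³·Haar_{SU(2)}{Re tr(1 − V) ≤ t}` for all `λ ≥ 1` and all real `t` —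
V38's `exists_haarReal_traceWindow_doubling` for `N = 2` with the sharp constant (the refuter NE7bREF-G99-POST3's `D_true = 1`). [folklore] -/
theorem haarReal_traceWindow_doubling_one {l : ℝ} (hl : 1 ≤ l) (t : ℝ) :
    (haarProbability (Matrix.specialUnitaryGroup (Fin 2) ℂ)).real {V : Matrix.specialUnitaryGroup (Fin 2) ℂ | (Matrix.trace (1 - (V : Matrix (Fin 2) (Fin 2) ℂ))).re ≤ l ^ 2 * t}
      ≤ l ^ 3 * (haarProbability (Matrix.specialUnitaryGroup (Fin 2) ℂ)).real {V : Matrix.specialUnitaryGroup (Fin 2) ℂ | (Matrix.trace (1 - (V : Matrix (Fin 2) (Fin 2) ℂ))).re ≤ t} := by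
  set μ := haarProbability (Matrix.specialUnitaryGroup (Fin 2) ℂ) with hμ
  -- the window function `m t = Haar{Re tr(1 − V) ≤ t} = Haar{2 − t ≤ Re tr V}`
  have hset : ∀ s : ℝ, {V : Matrix.specialUnitaryGroup (Fin 2) ℂ | (Matrix.trace (1 - (V : Matrix (Fin 2) (Fin 2) ℂ))).re ≤ s}
      = {V : Matrix.specialUnitaryGroup (Fin 2) ℂ | 2 - s ≤ (Matrix.trace (V : Matrix (Fin 2) (Fin 2) ℂ)).re} := fun s => by
    ext V; simp only [Set.mem_setOf_eq, re_trace_one_sub_eq]; constructor <;> intro h <;> linarith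
  have key := doubling_one_of_capLaw (fun s => μ.real {V : Matrix.specialUnitaryGroup (Fin 2) ℂ | (Matrix.trace (1 - (V : Matrix (Fin 2) (Fin 2) ℂ))).re ≤ s})
    ?_ (fun s => measureReal_le_one) ?_ ?_ hl t
  · simpa only using key
  · intro ψ h0 hπ
    show μ.real _ = _
    rw [hset, show 2 - (2 - 2 * Real.cos ψ) = 2 * Real.cos ψ by ring, measureReal_def, haar_traceCap_angle_eq h0 hπ,
      ENNReal.toReal_ofReal (div_nonneg (CompactFibreWindowSU2Doubling.capFun_nonneg h0) Real.pi_pos.le)]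
  · intro s hs
    show μ.real _ = _
    have huniv : {V : Matrix.specialUnitaryGroup (Fin 2) ℂ | (Matrix.trace (1 - (V : Matrix (Fin 2) (Fin 2) ℂ))).re ≤ s} = Set.univ :=
      Set.eq_univ_of_forall fun V => by
        rw [Set.mem_setOf_eq, re_trace_one_sub_eq]; linarith [(abs_le.1 (abs_re_trace_le_two V)).1]
    rw [huniv, probReal_univ]
  · intro s hs
    show μ.real _ = _
    have hemp : {V : Matrix.specialUnitaryGroup (Fin 2) ℂ | (Matrix.trace (1 - (V : Matrix (Fin 2) (Fin 2) ℂ))).re ≤ s} = ∅ :=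
      Set.eq_empty_of_forall_notMem fun V hV => by
        rw [Set.mem_setOf_eq, re_trace_one_sub_eq] at hV; linarith [(abs_le.1 (abs_re_trace_le_two V)).2]
    rw [hemp, measureReal_empty]

end Summit.QuantumFields.BalabanUV.T4Continuum.NE7b.CompactFibreWindowSU2DoublingHaar

end
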